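import Literature.Probability.LatticeModels.SpinTraversalSectors
import Literature.Probability.LatticeModels.IsingBandCrossingBound
import Literature.Probability.LatticeModels.FKIsingInterfaceTightnessProofs
import HarnessLib

/-!
# The Aizenman–Burchard traversal bound for the leftmost critical Ising interface, from the FK-Ising RSW bound

Topic `Literature/Probability/LatticeModels` (trunk `StatMech`, family `crit-ising`). This file
assembles the spin-Ising sibling of `FKIsingInterfaceTightnessProofs.lean`: the Aizenman–Burchard
hypothesis (Duke Math. J. 99 (1999), Thm. 1.1 / hypothesis H1, in the form of
`InterfaceSLETightness.spinInterface_traversalBound`) for the **leftmost** Dobrushin interface of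
the critical Ising model on the square-lattice approximations `(Ω_δ; a_δ, b_δ)` of a Jordan
domain, from the RSW-type crossing bound of the critical FK-Ising model (`fkIsing_rsw`,
Duminil-Copin–Hongler–Nolin 2011; Chelkak–Duminil-Copin–Hongler 2016), as indicated in
Chelkak–Duminil-Copin–Hongler–Kemppainen–Smirnov, C. R. Math. 352 (2014), §1–§2 ("We assume
`γ^δ` to be the rightmost (or the leftmost) interface"; Rem. 4: the required a-priori estimates
follow from [CDCH13, Cor. 1.7]) and Kemppainen–Smirnov, Ann. Probab. 45 (2017), Rem. 2.10 / §4: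

  `leftmostInterface_traversalBound_of_fkIsing_rsw (h₁ : fkIsing_rsw) :
    ∀ D E, IsDiscretisation D E → ∃ k K λ δ₀, 0 ≤ K ∧ 2 < λ ∧ 0 < δ₀ ∧ ∀ δ ∈ (0, δ₀], admissible →
      ∀ x ρ R, δ ≤ ρ < R ≤ 1 →
        μ_{E δ} {σ | the polygon of the leftmost interface of σ has k(x,ρ,R) traversals of D(x;ρ,R)}
          ≤ K (ρ/R)^λ`  (`λ = 3`, `K = 4000³`, `k = 2 (j + ⌊1/θ_ρ⌋ + 1)`).

Proof (all ingredients proved in sibling files, modulo `fkIsing_rsw`):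
* `SpinTraversalSectors.plusArmsAvoiding_of_hasTraversals` — `2(j + N)` traversals force `j`
  local `+` paths across a band of lattice levels about `x`, in distinct local `+` clusters of the
  free band sites and not locally joined to a neighbour of the `+` arc (sector argument of
  Aizenman–Burchard, App. A, with the cut set of the leftmost interface and its `+` left chain);
* `IsingMultiCrossing.isingMeasure_real_plusArmsAvoiding_inter_le` — by successive conditioning
  on explored local `+` clusters (domain Markov property + insulation by the revealed `−`
  frontier and the `−` arc; no BK inequality), `j` such arms cost `θ^j`, where
* `IsingBandCrossingBound.isingMeasure_real_plusCrossing_le_pow_of_insulated` — one `+` crossing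
  of the band costs `θ = (1 - c')^{m+1}`, `m + 1 ≍ log₂₉ (R/ρ)` stacked annuli, by the
  bc-uniform annulus bound from `fkIsing_rsw` (Edwards–Sokal coupling, FKG);
* the transfer `isingZdDobrushinMeasure E = μ^{dobrushinBC}_{zdInterior}` on `ℤ²` (interior sites
  have the same neighbours in `Ω_δ` and in `ℤ²`), and the exponent bookkeeping
  `((1 - c')^{m+1})^j ≤ 4000³ (ρ/R)³` once `(1 - c')^j ≤ 29⁻³`.

This is the corrected (leftmost) form of the mis-stated named fact
`spinInterface_traversalBound`, which quantifies over ALL Dobrushin interfaces of `σ`; the source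
(CDHKS 2014, §1) fixes the leftmost/rightmost interface, and the all-interfaces supremum is not a
printed result. As in `InterfaceSLETightness.lean` (there from the named fact, for an arbitrary
selection rule), the bound yields the tightness of the laws of the leftmost interface near
`δ = 0` (`exists_isTightMeasureSet_spinInterfaceLaw_leftmost`,
`isTightAlongMesh_spinInterfaceCurve_leftmost`; CDHKS Thm. 3 for the leftmost interface, modulo
`fkIsing_rsw`).

## References

* D. Chelkak, H. Duminil-Copin, C. Hongler, A. Kemppainen, S. Smirnov, *Convergence of Ising
  interfaces to Schramm's SLE curves*, C. R. Math. Acad. Sci. Paris 352 (2014) 157–161, §1–§2,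
  Rem. 4. [CDHKSCRAS2014]
* A. Kemppainen, S. Smirnov, Ann. Probab. 45 (2017), Thm. 1.6, Rem. 2.10, §4. [KemppainenSmirnov2017]
* M. Aizenman, A. Burchard, Duke Math. J. 99 (1999), Thm. 1.1, App. A. [AizenmanBurchardDuke1999]
* H. Duminil-Copin, S. Smirnov, Clay Math. Proc. 15 (2012), Thm. 6.1, (6.1)–(6.2). [DuminilCopinSmirnov2012Clay]
-/

noncomputable section

namespace Literature.Probability.LatticeModels

open MeasureTheory Set Metric Literature.Probability.Percolation
open scoped ENNReal

/-! ### The Dobrushin Ising measure of the polygonal domain as a measure on `ℤ²` -/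

section Transfer

variable {V : Type*} [DecidableEq V]

/-- Edges touching a volume only depend on the neighbourhoods of its sites. [folklore] -/
theorem edgesTouching_congr {G G' : SimpleGraph V} [G.LocallyFinite] [G'.LocallyFinite] {Λ : Finset V}
    (h : ∀ x ∈ Λ, ∀ y, G.Adj x y ↔ G'.Adj x y) : edgesTouching G Λ = edgesTouching G' Λ := by
  ext e
  simp only [edgesTouching, Finset.mem_biUnion, SimpleGraph.mem_incidenceFinset]
  refine exists_congr fun x ↦ and_congr_right fun hx ↦ ?_
  induction e using Sym2.ind with
  | h a b =>
    rw [SimpleGraph.mk'_mem_incidenceSet_iff, SimpleGraph.mk'_mem_incidenceSet_iff]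
    refine and_congr_left fun hab ↦ ?_
    rcases hab with rfl | rfl
    · exact h _ hx b
    · rw [G.adj_comm, G'.adj_comm]; exact h _ hx a

/-- **The finite-volume Gibbs measure with fixed boundary condition only depends on the
neighbourhoods of the sites of the volume** (the Hamiltonian sums over the edges touching `Λ`).
[cite: FriedliVelenik2017, §3.1, eq. (3.6)] -/
theorem isingMeasure_fixed_congr_graph {G G' : SimpleGraph V} [G.LocallyFinite] [G'.LocallyFinite] {Λ : Finset V}
    (h : ∀ x ∈ Λ, ∀ y, G.Adj x y ↔ G'.Adj x y) (β hh : ℝ) (η : SpinConfig V) :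
    isingMeasure G Λ β hh (.fixed η) = isingMeasure G' Λ β hh (.fixed η) := by
  have hH : isingHamiltonian G Λ hh (.fixed η) = isingHamiltonian G' Λ hh (.fixed η) := by
    funext σ
    rw [isingHamiltonian, isingHamiltonian, interactionEdges_fixed, interactionEdges_fixed, edgesTouching_congr h]
  unfold isingMeasure
  rw [hH]

end Transfer

/-- Interior sites of `Ω_δ` have the same neighbours in `Ω_δ` and in `ℤ²`. [cite: CDHKSCRAS2014, §1] -/
theorem adj_iff_of_mem_zdInteriorFinset {E : DiscreteDobrushin} (hΩ : Bornology.IsBounded E.Ω) (hδ : 0 < E.δ)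
    {x : Site 2} (hx : x ∈ zdInteriorFinset E) (y : Site 2) :
    (discreteDomainGraph E.Ω E.δ).Adj x y ↔ (zdGraph 2).Adj x y := by
  have hx' : x ∈ meshDomain E.Ω E.δ \ E.zdBoundary := by rw [← coe_zdInteriorFinset hΩ hδ]; exact hx
  refine ⟨fun h ↦ meshGraph_le_zdGraph _ _ (discreteDomainGraph_le_meshGraph _ _ h), fun h ↦ ?_⟩
  by_contra hn
  exact hx'.2 (E.meshBoundary_subset_zdBoundary (mem_meshBoundary_iff.2 ⟨hx'.1, y, h, hn⟩))

/-- **The polygonal Dobrushin Ising measure is the `ℤ²` Ising measure in the free volume with the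
Dobrushin boundary spins.** [cite: CDHKSCRAS2014, §1] -/
theorem isingZdDobrushinMeasure_eq_zdGraph {E : DiscreteDobrushin} (hΩ : Bornology.IsBounded E.Ω) (hδ : 0 < E.δ) (β : ℝ) :
    isingZdDobrushinMeasure E β = isingMeasure (zdGraph 2) (zdInteriorFinset E) β 0 (.fixed (dobrushinBC E)) :=
  isingMeasure_fixed_congr_graph (fun _ hx y ↦ adj_iff_of_mem_zdInteriorFinset hΩ hδ hx y) β 0 _

/-! ### Arithmetic of the exponent -/

/-- **The exponent bookkeeping** (base `29`): if `0 ≤ θ`, `θ^j ≤ 29⁻³`, `29^(m+2) > Q ≥ R/(88ρ) - 2`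
and `R ≥ 4000 ρ > 0`, then `(θ^(m+1))^j ≤ 4000³ (ρ/R)³`. [folklore] -/
theorem pow_pow_le_of_annuli29 {θ ρ R Q : ℝ} {j m : ℕ} (hθ : 0 ≤ θ) (hθj : θ ^ j ≤ 1 / 29 ^ 3)
    (hρ : 0 < ρ) (hR : 4000 * ρ ≤ R) (hQ : R / (88 * ρ) - 2 ≤ Q) (hm : Q < (29 : ℝ) ^ (m + 2)) :
    (θ ^ (m + 1)) ^ j ≤ (4000 : ℝ) ^ 3 * (ρ / R) ^ 3 := by
  have hRpos : 0 < R := by linarith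
  -- `29^(m+1) ≥ R / (4000 ρ)`
  have h29 : R / (4000 * ρ) ≤ (29 : ℝ) ^ (m + 1) := by
    have h1 : R / (88 * ρ) - 2 < 29 * (29 : ℝ) ^ (m + 1) := by rw [pow_succ] at hm; linarith
    have hRρ : 4000 ≤ R / ρ := by rw [le_div_iff₀ hρ]; linarith
    have e1 : R / (88 * ρ) = (R / ρ) / 88 := by field_simp
    have e2 : R / (4000 * ρ) = (R / ρ) / 4000 := by field_simp
    rw [e2]
    rw [e1] at h1
    nlinarith
  -- `(θ^(m+1))^j = (θ^j)^(m+1) ≤ (29⁻³)^(m+1) = ((29^(m+1))⁻¹)^3`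
  have hswap : (θ ^ (m + 1)) ^ j = (θ ^ j) ^ (m + 1) := by rw [← pow_mul, ← pow_mul, mul_comm]
  rw [hswap]
  have h1 : (θ ^ j) ^ (m + 1) ≤ (1 / 29 ^ 3 : ℝ) ^ (m + 1) := pow_le_pow_left₀ (by positivity) hθj _
  have h2 : (1 / 29 ^ 3 : ℝ) ^ (m + 1) = (((29 : ℝ) ^ (m + 1))⁻¹) ^ 3 := by
    rw [one_div, inv_pow, inv_pow, ← pow_mul, ← pow_mul, mul_comm]
  have hpos : 0 < R / (4000 * ρ) := by positivity
  have h3 : ((29 : ℝ) ^ (m + 1))⁻¹ ≤ 4000 * (ρ / R) := by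
    rw [inv_le_comm₀ (by positivity) (by positivity)]
    rw [show (4000 * (ρ / R))⁻¹ = R / (4000 * ρ) by field_simp]
    exact h29
  calc (θ ^ j) ^ (m + 1) ≤ (((29 : ℝ) ^ (m + 1))⁻¹) ^ 3 := h1.trans h2.le
    _ ≤ (4000 * (ρ / R)) ^ 3 := pow_le_pow_left₀ (by positivity) h3 3
    _ = (4000 : ℝ) ^ 3 * (ρ / R) ^ 3 := by ring

/-! ### The traversal bound for the leftmost interface -/

/-- **The Aizenman–Burchard traversal bound (H1) for the leftmost critical Ising interface, from
`fkIsing_rsw`.** For every Jordan domain with two marked boundary points and every admissible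
family of square-lattice discretisations, there are `k`, `K ≥ 0`, `λ = 3 > 2` and `δ₀ = 1` such
that for `0 < δ ≤ δ₀`, `δ ≤ ρ < R ≤ 1` and every `x`, the probability that the polygon of the
leftmost Dobrushin interface traverses `D(x; ρ, R)` `k(x, ρ, R)` times is at most `K (ρ/R)^λ`.
This is the statement CDHKS 2014 use for the leftmost/rightmost interface (§1–§2, Rem. 4), here
derived along Kemppainen–Smirnov's route (Rem. 2.10: a `+` path on the left of the leftmost
interface; annulus crossing bounds uniform in the boundary conditions) from the FK-Ising RSW
bound. See the module docstring for the architecture. [cite: CDHKSCRAS2014, §2 Rem. 4; KemppainenSmirnov2017, Rem. 2.10] -/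
theorem leftmostInterface_traversalBound_of_fkIsing_rsw (h₁ : fkIsing_rsw) :
    ∀ (D : RandomPlanarGeometry.DobrushinDomain) (E : ℝ → DiscreteDobrushin), IsDiscretisation D E →
    ∃ (k : ℂ → ℝ → ℝ → ℕ) (K lam δ₀ : ℝ), 0 ≤ K ∧ 2 < lam ∧ 0 < δ₀ ∧
      ∀ δ ∈ Set.Ioc (0 : ℝ) δ₀, (E δ).IsZdAdmissible →
        ∀ (x : ℂ) (ρ R : ℝ), δ ≤ ρ → ρ < R → R ≤ 1 →
          isingZdDobrushinMeasure (E δ) criticalBetaTwo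
            {σ | (spinPolygon δ (leftmostInterface (E δ) σ)).HasTraversals (k x ρ R) x ρ R} ≤
            ENNReal.ofReal (K * (ρ / R) ^ lam) := by
  classical
  intro D E hE
  obtain ⟨c', hc'pos, hc'1, hband2⟩ := isingMeasure_real_plusCrossing_le_pow_of_insulated h₁
  -- a one-annulus bound in `[1/2, 1)`
  set θ₁ : ℝ := max (1 - c') (1 / 2) with hθ₁
  have hθ₁1 : θ₁ < 1 := max_lt (by linarith) (by norm_num)
  have hθ₁pos : 0 < θ₁ := lt_max_of_lt_right (by norm_num)
  have hθ₁ge : 1 - c' ≤ θ₁ := le_max_left _ _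
  -- `j` with `θ₁^j ≤ 29⁻³`
  obtain ⟨j, hj⟩ : ∃ j : ℕ, θ₁ ^ j ≤ 1 / 29 ^ 3 := by
    obtain ⟨j, hj⟩ := exists_pow_lt_of_lt_one (show (0 : ℝ) < 1 / 29 ^ 3 by norm_num) hθ₁1
    exact ⟨j, hj.le⟩
  -- boundary modulus at scale `ρ`
  have hmodex : ∀ ρ : ℝ, 0 < ρ → ∃ θ : ℝ, 0 < θ ∧ ∀ s t : ℝ, |s - t| < θ → dist (D.boundary s) (D.boundary t) < ρ :=
    fun ρ hρ ↦ JordanDomain.exists_modulus D.toJordanDomain hρ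
  choose! θf hθf hmodf using hmodex
  refine ⟨fun _ ρ _ ↦ 2 * (j + (⌊1 / θf ρ⌋₊ + 1)), (4000 : ℝ) ^ 3, 3, 1, by positivity, by norm_num, one_pos, ?_⟩
  rintro δ ⟨hδ0, hδ1⟩ hadm x ρ R hδρ hρR hR1
  have hρ : 0 < ρ := hδ0.trans_le hδρ
  have hRpos : 0 < R := hρ.trans hρR
  rw [show (3 : ℝ) = ((3 : ℕ) : ℝ) by norm_num, Real.rpow_natCast]
  -- the trivial regime `R < 4000 ρ`
  by_cases hsmall : R < 4000 * ρ
  · calc _ ≤ (1 : ℝ≥0∞) := prob_le_one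
      _ ≤ ENNReal.ofReal ((4000 : ℝ) ^ 3 * (ρ / R) ^ 3) := by
        rw [← ENNReal.ofReal_one]
        apply ENNReal.ofReal_le_ofReal
        have h1 : 1 ≤ 4000 * (ρ / R) := by
          rw [mul_div_assoc', le_div_iff₀ hRpos]; linarith
        calc (1 : ℝ) = 1 ^ 3 := by norm_num
          _ ≤ (4000 * (ρ / R)) ^ 3 := pow_le_pow_left₀ zero_le_one h1 3
          _ = _ := by ring
  push Not at hsmall
  /- the main regime: notation -/
  set E' := E δ with hE'
  have hΩ : E'.Ω = D.carrier := hE.Ω_eq δ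
  have hδ' : E'.δ = δ := hE.δ_eq δ
  have hδpos : 0 < E'.δ := by rw [hδ']; exact hδ0
  have hΩb : Bornology.IsBounded E'.Ω := by rw [hΩ]; exact D.isBounded
  -- radii and levels
  set r₁ : ℝ := 15 * ρ with hr₁
  set r₂ : ℝ := R / 2 - 8 * ρ with hr₂
  set x₀ : Site 2 := nearSite δ x with hx₀
  set nᵢ : ℤ := ⌊(r₁ + 6 * δ) / δ⌋ + 1 with hnᵢ
  set nₒ : ℤ := ⌊(r₂ - 4 * δ) / (2 * δ)⌋ - 2 with hnₒ
  have hfl₁ := Int.floor_le ((r₁ + 6 * δ) / δ)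
  have hfl₁' := Int.lt_floor_add_one ((r₁ + 6 * δ) / δ)
  have hfl₂ := Int.floor_le ((r₂ - 4 * δ) / (2 * δ))
  have hfl₂' := Int.lt_floor_add_one ((r₂ - 4 * δ) / (2 * δ))
  have hnᵢ_real : (r₁ + 6 * δ) / δ < nᵢ ∧ (nᵢ : ℝ) ≤ (r₁ + 6 * δ) / δ + 1 := by
    rw [hnᵢ]; push_cast; constructor <;> linarith
  have hnₒ_real : (r₂ - 4 * δ) / (2 * δ) - 3 < nₒ ∧ (nₒ : ℝ) ≤ (r₂ - 4 * δ) / (2 * δ) - 2 := by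
    rw [hnₒ]; push_cast; constructor <;> linarith
  have hδne : δ ≠ 0 := hδ0.ne'
  have hρδ : 1 ≤ ρ / δ := by rw [le_div_iff₀ hδ0]; linarith
  have e1 : (r₁ + 6 * δ) / δ = 15 * (ρ / δ) + 6 := by rw [hr₁]; field_simp
  have e2 : (r₂ - 4 * δ) / (2 * δ) = R / (4 * δ) - 4 * (ρ / δ) - 2 := by rw [hr₂]; field_simp; ring
  -- the level/distance dictionary
  have hin : ∀ z : Site 2, dist (meshPoint δ z) x ≤ r₁ + 4 * δ → supLevel x₀ z < nᵢ := by
    intro z hz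
    have h := mul_supLevel_le_dist_add hδ0 x z
    rw [← hx₀] at h
    have h' : (supLevel x₀ z : ℝ) ≤ (r₁ + 6 * δ) / δ := by
      rw [le_div_iff₀ hδ0]; linarith
    exact_mod_cast h'.trans_lt hnᵢ_real.1
  have hout : ∀ z : Site 2, r₂ - 4 * δ ≤ dist (meshPoint δ z) x → nₒ < supLevel x₀ z := by
    intro z hz
    have h := dist_le_two_mul_supLevel hδ0 x z
    rw [← hx₀] at h
    have h' : (r₂ - 4 * δ) / (2 * δ) - 1 ≤ supLevel x₀ z := by
      rw [sub_le_iff_le_add, div_le_iff₀ (by positivity)]; linarith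
    have : (nₒ : ℝ) < supLevel x₀ z := by linarith [hnₒ_real.2]
    exact_mod_cast this
  have hband : ∀ z : Site 2, nᵢ ≤ supLevel x₀ z → supLevel x₀ z ≤ nₒ →
      r₁ + 5 * δ ≤ dist (meshPoint δ z) x ∧ dist (meshPoint δ z) x ≤ r₂ - 5 * δ := by
    intro z h1 h2
    have h1' : (nᵢ : ℝ) ≤ supLevel x₀ z := by exact_mod_cast h1
    have h2' : (supLevel x₀ z : ℝ) ≤ nₒ := by exact_mod_cast h2
    have hlo := mul_supLevel_le_dist_add hδ0 x z
    have hhi := dist_le_two_mul_supLevel hδ0 x z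
    rw [← hx₀] at hlo hhi
    constructor
    · have : (r₁ + 6 * δ) / δ < supLevel x₀ z := hnᵢ_real.1.trans_le h1'
      rw [div_lt_iff₀ hδ0] at this
      linarith
    · have : (supLevel x₀ z : ℝ) ≤ (r₂ - 4 * δ) / (2 * δ) - 2 := h2'.trans hnₒ_real.2
      rw [le_sub_iff_add_le, le_div_iff₀ (by positivity)] at this
      linarith
  have hR' : 1000 * (ρ / δ) ≤ R / (4 * δ) := by
    rw [show 1000 * (ρ / δ) = (4000 * ρ) / (4 * δ) by field_simp; ring]
    gcongr
  have hnᵢle : (nᵢ : ℝ) ≤ 22 * (ρ / δ) := by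
    have h1 := hnᵢ_real.2; rw [e1] at h1; linarith
  have hnᵢge : 15 * (ρ / δ) + 6 < nᵢ := by
    have h1 := hnᵢ_real.1; rwa [e1] at h1
  have hnₒge : R / (4 * δ) - 9 * (ρ / δ) ≤ nₒ := by
    have := hnₒ_real.1; rw [e2] at this; linarith
  have hnio : nᵢ < nₒ := by
    have : (nᵢ : ℝ) < nₒ := by linarith
    exact_mod_cast this
  have hnᵢ1 : 1 ≤ nᵢ := by
    have : (1 : ℝ) < nᵢ := by linarith
    exact_mod_cast this.le
  /- the stacked annuli: `n i = nᵢ 29^i`, `i ≤ m`, `29^(m+1) nᵢ ≤ nₒ` -/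
  set n₀ : ℕ := nᵢ.toNat with hn₀
  have hn₀ : (n₀ : ℤ) = nᵢ := Int.toNat_of_nonneg (by omega)
  have hn₀1 : 1 ≤ n₀ := by omega
  set Qn : ℕ := nₒ.toNat / n₀ with hQn
  have hnₒ0 : 0 ≤ nₒ := by omega
  have hnₒnat : (nₒ.toNat : ℤ) = nₒ := Int.toNat_of_nonneg hnₒ0
  -- `Qn ≥ 29`
  have hQn29 : 29 ≤ Qn := by
    rw [hQn, Nat.le_div_iff_mul_le (by omega)]
    have : (29 * nᵢ : ℝ) ≤ nₒ := by linarith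
    have h' : 29 * nᵢ ≤ nₒ := by exact_mod_cast this
    omega
  set m : ℕ := Nat.log 29 Qn - 1 with hm
  have hlog1 : 1 ≤ Nat.log 29 Qn := Nat.le_log_of_pow_le (by norm_num) (by simpa using hQn29)
  have hm1 : m + 1 = Nat.log 29 Qn := by omega
  have hpowle : 29 ^ (m + 1) ≤ Qn := by rw [hm1]; exact Nat.pow_log_le_self 29 (by omega)
  have hpowgt : Qn < 29 ^ (m + 2) := by
    rw [show m + 2 = Nat.log 29 Qn + 1 by omega]
    exact Nat.lt_pow_succ_log_self (by norm_num) Qn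
  set n : ℕ → ℕ := fun i ↦ n₀ * 29 ^ i with hn
  have hn0 : 1 ≤ n 0 := by simp [hn]; omega
  have hgrow : ∀ i, 29 * n i ≤ n (i + 1) := fun i ↦ by simp only [hn, pow_succ]; nlinarith
  have hntop : ∀ i ≤ m, (29 * (n i : ℤ)) ≤ nₒ := by
    intro i hi
    have h1 : 29 * n i ≤ n₀ * 29 ^ (m + 1) := by
      simp only [hn]
      calc 29 * (n₀ * 29 ^ i) = n₀ * 29 ^ (i + 1) := by ring
        _ ≤ n₀ * 29 ^ (m + 1) := Nat.mul_le_mul_left _ (Nat.pow_le_pow_right (by norm_num) (by omega))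
    have h2 : n₀ * 29 ^ (m + 1) ≤ n₀ * Qn := Nat.mul_le_mul_left _ hpowle
    have h3 : n₀ * Qn ≤ nₒ.toNat := by rw [hQn, mul_comm]; exact Nat.div_mul_le_self _ _
    have : ((29 * n i : ℕ) : ℤ) ≤ (nₒ.toNat : ℤ) := by exact_mod_cast h1.trans (h2.trans h3)
    push_cast at this
    linarith
  have hnbot : ∀ i, (nᵢ : ℤ) ≤ n i := by
    intro i
    have : n₀ ≤ n i := by simp only [hn]; exact Nat.le_mul_of_pos_right _ (by positivity)
    have : (n₀ : ℤ) ≤ n i := by exact_mod_cast this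
    omega
  /- the free band sites, sources, targets, seeds; the insulating band -/
  set U₀ := spinBandSites E' x₀ nᵢ nₒ with hU₀
  set In := spinBandIn E' x₀ nᵢ nₒ with hIn
  set Out := spinBandOut E' x₀ nᵢ nₒ with hOut
  set Z := spinBandSeeds E' x₀ nᵢ nₒ with hZ
  set T₀ : Set (Site 2) := {v | nᵢ ≤ supLevel x₀ v ∧ supLevel x₀ v ≤ nₒ} with hT₀
  set Λ := zdInteriorFinset E' with hΛ
  set η := dobrushinBC E' with hη
  have hZU : Z ⊆ U₀ := Finset.filter_subset _ _
  have hU₀Λ : U₀ ⊆ Λ := Finset.filter_subset _ _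
  have hInlev : ∀ a ∈ In, supLevel x₀ a ≤ 6 * (n 0 : ℤ) - 1 := by
    intro a ha
    rw [hIn, mem_spinBandIn] at ha
    rw [ha.2]
    have := hnbot 0
    omega
  have hOutlev : ∀ b ∈ Out, 12 * (n m : ℤ) + 1 ≤ supLevel x₀ b := by
    intro b hb
    rw [hOut, mem_spinBandOut] at hb
    rw [hb.2]
    have h1 := hntop m le_rfl
    have h2 : (1 : ℤ) ≤ n m := by have := hnbot m; omega
    linarith
  have hT₀ann : ∀ i ≤ m, ∀ v ∈ annulusInterior x₀ (n i), v ∈ T₀ := by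
    intro i hi v hv
    rw [mem_annulusInterior] at hv
    have h1 := hnbot i; have h2 := hntop i hi
    exact ⟨by omega, by omega⟩
  -- one crossing of the band costs `(1 - c')^(m+1)`
  have hbase : ∀ U ⊆ U₀, ∀ ξ : SpinConfig (Site 2), PlusInsulated (zdGraph 2) T₀ U ξ →
      (isingMeasure (zdGraph 2) U criticalBetaTwo 0 (.fixed ξ)).real (plusCrossing (zdGraph 2) U In Out) ≤
        (1 - c') ^ (m + 1) :=
    fun U _ ξ hins ↦ hband2 x₀ n hn0 hgrow m T₀ hT₀ann In Out U hInlev hOutlev ξ hins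
  -- the insulation hypothesis of the successive conditioning: band sites outside the free band
  -- sites but next to them are boundary sites: `−` (arc `b_δ`) or handled by the seeds (arc `a_δ`)
  have hT : ∀ v ∈ T₀, v ∉ U₀ → (∃ u ∈ U₀, (zdGraph 2).Adj u v) → (v ∉ Λ ∧ η v = -1) ∨ ∀ u ∈ U₀, (zdGraph 2).Adj u v → u ∈ Z := by
    intro v hv hvU ⟨u, hu, huv⟩
    have huI := (mem_spinBandSites.1 hu).1
    have hGd : (discreteDomainGraph E'.Ω E'.δ).Adj u v := (adj_iff_of_mem_zdInteriorFinset hΩb hδpos huI v).2 huv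
    have hvD : v ∈ meshDomain E'.Ω E'.δ := (discreteDomainGraph_adj_iff.1 hGd).2.2
    have hvB : v ∈ E'.zdBoundary := by
      by_contra hvB
      apply hvU
      rw [hU₀, mem_spinBandSites]
      refine ⟨?_, hv.1, hv.2⟩
      rw [← Finset.mem_coe, coe_zdInteriorFinset hΩb hδpos]
      exact ⟨hvD, hvB⟩
    by_cases hvA : v ∈ E'.zdArcA
    · right
      intro u' hu' hu'v
      rw [hZ, mem_spinBandSeeds]
      exact ⟨hu', v, hvA, hu'v⟩
    · left
      exact ⟨notMem_zdInteriorFinset_of_mem_zdBoundary hvB, dobrushinBC_of_not_mem hvA⟩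
  /- the probability -/
  set Trav : Set (SpinConfig (Site 2)) :=
    {σ | (spinPolygon δ (leftmostInterface E' σ)).HasTraversals (2 * (j + (⌊1 / θf ρ⌋₊ + 1))) x ρ R} with hTrav
  set Arms : Set (SpinConfig (Site 2)) := plusArmsAvoiding (zdGraph 2) U₀ In Out Z j with hArms
  change isingZdDobrushinMeasure E' criticalBetaTwo Trav ≤ _
  -- Step A: traversals force separated arms avoiding the `+` arc
  have hincl : Trav ⊆ Arms := by
    intro σ hσ
    have htr : (spinPolygon E'.δ (leftmostInterface E' σ)).HasTraversals (2 * (j + (⌊1 / θf ρ⌋₊ + 1))) x ρ R := by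
      rw [hδ']; exact hσ
    exact plusArmsAvoiding_of_hasTraversals hΩ hadm σ (x := x) (ρ := ρ) (R := R) (q₁ := 7 * ρ) (q₂ := R / 2)
      (r₁ := r₁) (r₂ := r₂) (by linarith) hρ.le (by rw [hδ']; linarith) (by rw [hδ']; linarith)
      (by rw [hδ', hr₁]; linarith) (by rw [hδ', hr₂]; linarith) (by rw [hδ', hr₁, hr₂]; linarith)
      (hθf ρ hρ) (hmodf ρ hρ) x₀ hnio (by rw [hδ']; exact hband) (by rw [hδ']; exact hin)
      (by rw [hδ']; exact hout) htr
  -- Step B: the arms cost `((1 - c')^(m+1))^j`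
  rw [isingZdDobrushinMeasure_eq_zdGraph hΩb hδpos]
  set μ := isingMeasure (zdGraph 2) Λ criticalBetaTwo 0 (.fixed η) with hμ
  have hArms_le : μ.real Arms ≤ ((1 - c') ^ (m + 1)) ^ j := by
    letI : LinearOrder (Site 2) := LinearOrder.lift' (fun v : Site 2 ↦ toLex (v 0, v 1)) (by
      intro v w hvw
      simp only [toLex_inj, Prod.mk.injEq] at hvw
      funext k
      rcases fin_two_eq_zero_or_one k with rfl | rfl
      · exact hvw.1
      · exact hvw.2)
    have h := isingMeasure_real_plusArmsAvoiding_inter_le (zdGraph 2) criticalBetaTwo_pos.le T₀ In Out U₀ Z hZU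
      (θ := (1 - c') ^ (m + 1)) (by positivity) hbase j hU₀Λ η hT MeasurableSet.univ (fun _ _ _ ↦ Iff.rfl)
    rwa [Set.inter_univ, probReal_univ, mul_one] at h
  -- Step C: the exponent
  have hexp : ((1 - c') ^ (m + 1)) ^ j ≤ (4000 : ℝ) ^ 3 * (ρ / R) ^ 3 := by
    have h1 : ((1 - c') ^ (m + 1)) ^ j ≤ (θ₁ ^ (m + 1)) ^ j :=
      pow_le_pow_left₀ (by positivity) (pow_le_pow_left₀ (by linarith) hθ₁ge _) _
    refine h1.trans (pow_pow_le_of_annuli29 hθ₁pos.le hj hρ hsmall ?_ (by exact_mod_cast hpowgt) (Q := (Qn : ℝ)))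
    -- `Qn ≥ R/(88 ρ) - 2`
    have hQ1 : (nₒ.toNat : ℝ) < n₀ * (Qn + 1) := by
      have := Nat.lt_mul_div_succ nₒ.toNat (show 0 < n₀ by omega)
      rw [← hQn] at this
      exact_mod_cast this
    have h2 : (nₒ.toNat : ℝ) = nₒ := by exact_mod_cast hnₒnat
    have h3 : (n₀ : ℝ) = nᵢ := by exact_mod_cast hn₀
    rw [h2, h3] at hQ1
    have hQ0 : (0 : ℝ) ≤ Qn := Nat.cast_nonneg _
    have h4 : R / (4 * δ) - 9 * (ρ / δ) < 22 * (ρ / δ) * (Qn + 1) := by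
      have : (nᵢ : ℝ) * (Qn + 1) ≤ 22 * (ρ / δ) * (Qn + 1) := mul_le_mul_of_nonneg_right hnᵢle (by positivity)
      linarith
    have hρδpos : 0 < ρ / δ := by positivity
    have e3 : R / (4 * δ) = (R / (4 * ρ)) * (ρ / δ) := by field_simp
    rw [e3] at h4
    have h5 : R / (4 * ρ) - 9 < 22 * ((Qn : ℝ) + 1) := by
      by_contra hcon
      push Not at hcon
      have h6 : (22 * ((Qn : ℝ) + 1)) * (ρ / δ) ≤ (R / (4 * ρ) - 9) * (ρ / δ) :=
        mul_le_mul_of_nonneg_right hcon hρδpos.le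
      have h7 : (R / (4 * ρ) - 9) * (ρ / δ) = R / (4 * ρ) * (ρ / δ) - 9 * (ρ / δ) := by ring
      have h8 : (22 * ((Qn : ℝ) + 1)) * (ρ / δ) = 22 * (ρ / δ) * (Qn + 1) := by ring
      linarith
    have e4 : R / (88 * ρ) = R / (4 * ρ) / 22 := by field_simp; ring
    rw [e4]
    linarith
  calc μ Trav ≤ μ Arms := measure_mono hincl
    _ = ENNReal.ofReal (μ.real Arms) := (ofReal_measureReal (measure_ne_top _ _)).symm
    _ ≤ ENNReal.ofReal ((4000 : ℝ) ^ 3 * (ρ / R) ^ 3) := ENNReal.ofReal_le_ofReal (hArms_le.trans hexp)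

/-! ### Tightness of the laws of the leftmost interface -/

/-- **Tightness of the laws of the leftmost critical Ising interface near `δ = 0`, from
`fkIsing_rsw`** (CDHKS 2014, §2 Thm. 3, for the leftmost interface of §1; here via
Aizenman–Burchard, Thm. 1.2): for a discretisation `E` of `(D; a, b)` there is `δ₂ > 0` such
that the laws `spinInterfaceLaw D E (fun δ ↦ leftmostInterface (E δ)) δ`, `δ ∈ (0, δ₂]`, of the
polygon of the leftmost interface form a tight set of measures on `CurveClass ℂ`. The proof is
that of `exists_isTightMeasureSet_spinInterfaceLaw` (`InterfaceSLETightness.lean`), with (H0)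
from (C0) and (H1) supplied by `leftmostInterface_traversalBound_of_fkIsing_rsw` in place of the
named fact `spinInterface_traversalBound`; the leftmost interface is a Dobrushin interface for
admissible data (`isDobrushinInterface_leftmostInterface`).
[cite: CDHKSCRAS2014, §2 Thm. 3; AizenmanBurchardDuke1999, Thm. 1.2] -/
theorem exists_isTightMeasureSet_spinInterfaceLaw_leftmost (h₁ : fkIsing_rsw)
    {D : RandomPlanarGeometry.DobrushinDomain} {E : ℝ → DiscreteDobrushin} (hE : IsDiscretisation D E) :
    ∃ δ₂ > 0, IsTightMeasureSet
      (spinInterfaceLaw D E (fun δ ↦ leftmostInterface (E δ)) '' Set.Ioc 0 δ₂) := by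
  obtain ⟨r, hr⟩ := D.isBounded.subset_closedBall (0 : ℂ)
  obtain ⟨k, K, lam, δ₀, hK, hlam, hδ₀, hbd⟩ := leftmostInterface_traversalBound_of_fkIsing_rsw h₁ D E hE
  obtain ⟨δ₁, hδ₁, hadm⟩ := exists_forall_isZdAdmissible hE.eventually_isZdAdmissible
  refine ⟨min (min δ₀ 1) (δ₁ / 2), lt_min (lt_min hδ₀ one_pos) (by positivity), ?_⟩
  set δ₂ : ℝ := min (min δ₀ 1) (δ₁ / 2) with hδ₂
  have hT : Set.Ioc 0 δ₂ ⊆ Set.Ioc (0 : ℝ) 1 :=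
    Set.Ioc_subset_Ioc_right ((min_le_left _ _).trans (min_le_right _ _))
  have hT₀ : ∀ δ ∈ Set.Ioc 0 δ₂, δ ∈ Set.Ioc (0 : ℝ) δ₀ := fun δ hδ ↦
    ⟨hδ.1, hδ.2.trans ((min_le_left _ _).trans (min_le_left _ _))⟩
  have hT₁ : ∀ δ ∈ Set.Ioc 0 δ₂, (E δ).IsZdAdmissible := fun δ hδ ↦
    hadm δ hδ.1 (hδ.2.trans_lt ((min_le_right _ _).trans_lt (by linarith)))
  have hr₀ : (0 : ℝ) ≤ max r 0 + 1 := by positivity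
  have hr' : closedBall (0 : ℂ) r ⊆ closedBall 0 (max r 0 + 1) :=
    closedBall_subset_closedBall (by linarith [le_max_left r 0])
  have key := RandomPlanarGeometry.isTightMeasureSet_of_traversalBounds (E := ℂ)
    (isCompact_closedBall (0 : ℂ) (max r 0 + 1)) (C := 9 * (max r 0 + 1 + 2) ^ 2) (d := 2)
    zero_le_two (fun ρ hρ hρ1 ↦ RandomPlanarGeometry.exists_finset_card_le_cover_closedBall hr₀ ρ hρ hρ1)
    (Ω := fun _ ↦ SpinConfig (Site 2)) (fun δ ↦ isingZdDobrushinMeasure (E δ) criticalBetaTwo)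
    (fun δ σ ↦ spinOrientedPolygon D δ (leftmostInterface (E δ) σ))
    (fun x ρ R ↦ max spinTraversalCutoff (k x ρ R)) hK hlam hT ?_ ?_
  · simpa only [spinInterfaceLaw, spinInterfaceCurve_comp_eq] using key
  · -- (H0) from (C0), for every `σ`
    intro δ hδ
    have hδE : (E δ).δ = δ := hE.δ_eq δ
    have hΩE : (E δ).Ω ⊆ closedBall (0 : ℂ) r := by rw [hE.Ω_eq δ]; exact hr
    have hδ0 : 0 < (E δ).δ := by rw [hδE]; exact hδ.1
    refine ae_of_all _ fun σ ↦ ?_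
    have hγ : IsDobrushinInterface (E δ) σ (leftmostInterface (E δ) σ) :=
      isDobrushinInterface_leftmostInterface (hT₁ δ hδ) σ
    refine ⟨?_, fun x ρ R _ hρδ hρR htr ↦ ?_⟩
    · have h := spinPolygon_range_subset hγ hΩE
      rw [hδE] at h
      rw [range_spinOrientedPolygon]
      exact h.trans hr'
    · have h := not_hasTraversals_spinPolygon hδ0 hγ (x := x) (ρ := ρ) (R := R)
        (by rw [hδE]; exact hρδ) hρR
      rw [hδE] at h
      rw [hasTraversals_spinOrientedPolygon_iff] at htr
      exact h (htr.of_le (le_max_left _ _))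
  · -- (H1) from the traversal bound for the leftmost interface
    intro δ hδ x ρ R hδρ hρR hR1
    refine le_trans (measure_mono fun σ hσ ↦ ?_) (hbd δ (hT₀ δ hδ) (hT₁ δ hδ) x ρ R hδρ hρR hR1)
    simp only [mem_setOf_eq, hasTraversals_spinOrientedPolygon_iff] at hσ ⊢
    exact hσ.of_le (le_max_right _ _)

/-- The same tightness in the eventual, event-level vocabulary `IsTightAlongMesh` of
`SLEConvergenceCriterion.lean` (the interfaces are a.e.-measurable under the finitely supported
Ising measures). [cite: CDHKSCRAS2014, §2 Thm. 3] -/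
theorem isTightAlongMesh_spinInterfaceCurve_leftmost (h₁ : fkIsing_rsw)
    {D : RandomPlanarGeometry.DobrushinDomain} {E : ℝ → DiscreteDobrushin} (hE : IsDiscretisation D E) :
    RandomPlanarGeometry.IsTightAlongMesh (Ωδ := fun _ ↦ SpinConfig (Site 2))
      (fun δ σ ↦ spinInterfaceCurve D δ (leftmostInterface (E δ) σ))
      (fun δ ↦ isingZdDobrushinMeasure (E δ) criticalBetaTwo) := by
  obtain ⟨δ₂, hδ₂, h⟩ := exists_isTightMeasureSet_spinInterfaceLaw_leftmost h₁ hE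
  exact RandomPlanarGeometry.isTightAlongMesh_of_isTightMeasureSet_image
    (Filter.Eventually.of_forall fun δ ↦ aemeasurable_isingZdDobrushinMeasure _ _ _) hδ₂ h

end Literature.Probability.LatticeModels

end
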